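import Summits.CriticalPhenomena.PercolationContinuityZ3.Theorems.PercNearOneGluingNoHeavyQuantGatedSliceMixLawQRoutingDeep
import Summits.CriticalPhenomena.PercolationContinuityZ3.Theorems.PercNearOneGluingNoHeavyQuantLawDecUsageMonge
import HarnessLib

/-!
# QUANT lane R8, T-DEC, leg (III), blob case — `LawDec.GatedSliceMixLaw'`, cell A5 (unsaturated mid), SUB-CELL (iii): when the low `k₁`
# is INCOMPATIBLE with the mid `k₂` (`k₁ + k₂ ≤ t`), the moved law is DEC by itself (θ = 0)

builds on p205010 (kernel theorem, internal audit signed; external expert review pending)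

Support file (`--supports stmt-CriticalPhenomena-4575`), QUANT lane lead seat prim-quant-lead (gen 33), rung R8 of
`run/shared/lean/prim/quant/LADDER.md`.  Memo: typer g30 `…/prim-quant-stmt-g30/MIXLAW-MIXTURES-G30.md` §8 (iii); lead g33 NOTES.
One theorem, standard axioms, no sorries.  Tool: arm-1 g41's explicit routing theorem `mixLawQ_decAtT_of_routing_deep`.

THE SUB-CELL (plan Π-B2 (iii)).  Frame of cell A5 without the weak-mid atom: `k₁ ≥ 1` and `ℓ = k₁ + a` are `t`-lows
(`t = S + ag(1−z)`), `k₂ ≤ j` is a mid compatible with `ℓ` (`t < ℓ + k₂`), `k₂ + a` a giant, `k₂` NOT saturated by `ℓ`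
(`usage(ℓ,k₂)·m₁′ ≤ m₂`), and `k₁ + k₂ ≤ t` (the low `k₁` cannot use the mid).  ROUTING: `ℓ → k₂` entirely, `k₁ → k₂ + a`, the zero by
the offer of the giant.  THE INEQUALITY: `y·(z + m₁) ≤ (1 − y)·m₂′`, from the mean identity
`t·z = −(t−k₁)m₁ − (t−ℓ)m₁′ + (k₂−t)m₂ + (k₂+a−t)m₂′`, `y(k₂+a) ≤ t`, `k₂ ≤ t` and `k₁·m₁ ≤ (t−ℓ)·m₁′` — the last because
`k₁ + k₂ ≤ t = S + ag(1−z)` with `S ≤ k₂` forces `k₁ ≤ ag(1−z) ≤ a·g < (t − ℓ)·g`.  EXACT CENSUS (lead g33, explore/a5fstar.py,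
a5iii.py): 11 000 + 133 000 sub-cell instances (a ≤ 30, M ≤ 75), the moved law DEC in every one, this routing certifies all of them
(`y·m₁/((1−y)m₂′) ≤ 0.48`).

* **`LawDec.decAtT_movedTwoPoint_of_incomp`**.

[this work]; routing theorem: arm-1 g41; plan: typer g30.  The gluing rows served [cite: KozmaNitzan2024, Conjecture 3 (p. 15)]; product
measure [cite: Grimmett1999, §1.3 p. 10].
-/

noncomputable section

namespace Summit.CriticalPhenomena.PercolationContinuityZ3.Theorems

namespace Quant

open Finset

/-- the two-point law `{lo, hi; g}` (as in `…QuantLawDEC`) -/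
local notation3 "TP[" lo ", " hi ", " g ", " h "]" =>
  (g : ℝ) * (if (h : ℕ) = (hi : ℕ) then (1 : ℝ) else 0) + (1 - (g : ℝ)) * (if (h : ℕ) = (lo : ℕ) then (1 : ℝ) else 0)

namespace LawDec

set_option maxHeartbeats 800000 in
/-- **cell A5, sub-cell (iii): `k₁` incompatible with `k₂` ⟹ the moved law is DEC** (frame of `GatedSliceMixLaw'` without `h`;
`1 ≤ k₁`, `2(k₁+a) < t`, `k₁ + a ≤ j`; `k₂ ≤ j`, `2k₂ ≥ t`, `t < k₁ + a + k₂`; `k₂ + a ≥ j+1`; `usage(k₁+a,k₂)·m₁′ ≤ m₂`;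
`k₁ + k₂ ≤ t`). [this work] -/
theorem decAtT_movedTwoPoint_of_incomp (y z g S lam : ℝ) (a j M k₁ k₂ : ℕ)
    (hy0 : 0 < y) (hy1 : y < 1) (hz0 : 0 ≤ z) (hz1 : z < 1) (hg1 : g ≤ 1) (hyg : y ≤ (1 - z) * g) (ha : 1 ≤ a)
    (hta : y * (M : ℝ) ≤ S) (hk : k₁ ≤ k₂) (hk₂M : k₂ ≤ M) (hlam0 : 0 ≤ lam) (hlam1 : lam ≤ 1)
    (hmean : (1 - z) * ((k₁ : ℝ) + ((k₂ : ℝ) - k₁) * lam) = S)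
    (hk₁ : 1 ≤ k₁) (hllow : 2 * ((k₁ + a : ℕ) : ℝ) < S + (a : ℝ) * g * (1 - z)) (hlj : k₁ + a ≤ j)
    (hk₂j : k₂ ≤ j) (hk₂mid : S + (a : ℝ) * g * (1 - z) ≤ 2 * (k₂ : ℝ)) (hcompl : S + (a : ℝ) * g * (1 - z) < ((k₁ + a : ℕ) : ℝ) + k₂)
    (hk₂aG : j + 1 ≤ k₂ + a)
    (hunsat : usage y (S + (a : ℝ) * g * (1 - z)) j (k₁ + a) k₂ * ((1 - z) * (1 - lam) * g) ≤ (1 - z) * lam * (1 - g))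
    (hincomp : (k₁ : ℝ) + k₂ ≤ S + (a : ℝ) * g * (1 - z)) :
    DECAtT y (S + (a : ℝ) * g * (1 - z)) j (M + a)
      (fun p => z * (if p = 0 then (1 : ℝ) else 0) + (1 - z) * slice (fun q => TP[k₁, k₂, lam, q]) a g p) := by
  classical
  set t : ℝ := S + (a : ℝ) * g * (1 - z) with ht
  have h1z : 0 < 1 - z := by linarith
  have hg0 : 0 < g := by nlinarith
  have h1y : 0 < 1 - y := by linarith
  have ha0 : (0 : ℝ) ≤ a := Nat.cast_nonneg a
  have hk₁0 : (0 : ℝ) ≤ k₁ := Nat.cast_nonneg k₁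
  have hk₂0 : (0 : ℝ) ≤ k₂ := Nat.cast_nonneg k₂
  have h1lam : 0 ≤ 1 - lam := by linarith
  set A : ℝ := (1 - z) * (1 - lam) * (1 - g) with hA
  set B : ℝ := (1 - z) * (1 - lam) * g with hB
  set C : ℝ := (1 - z) * lam * (1 - g) with hC
  set D : ℝ := (1 - z) * lam * g with hD
  have hA0 : 0 ≤ A := mul_nonneg (mul_nonneg h1z.le h1lam) (by linarith)
  have hB0 : 0 ≤ B := mul_nonneg (mul_nonneg h1z.le h1lam) hg0.le
  have hC0 : 0 ≤ C := mul_nonneg (mul_nonneg h1z.le hlam0) (by linarith)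
  have hD0 : 0 ≤ D := mul_nonneg (mul_nonneg h1z.le hlam0) hg0.le
  have ht0 : 0 < t := by
    have : (0 : ℝ) ≤ ((k₁ + a : ℕ) : ℝ) := Nat.cast_nonneg _
    linarith
  -- top-affordability of the giant and the mean identity
  have htaG : y * (((k₂ + a : ℕ) : ℝ)) ≤ t := by
    have : ((k₂ + a : ℕ) : ℝ) ≤ ((M + a : ℕ) : ℝ) := by exact_mod_cast (by omega : k₂ + a ≤ M + a)
    push_cast at this ⊢; rw [ht]; nlinarith [mul_nonneg ha0 hg0.le]
  have hmeanid : t * z = -((t - k₁) * A) - (t - ((k₁ + a : ℕ) : ℝ)) * B + ((k₂ : ℝ) - t) * C + (((k₂ + a : ℕ) : ℝ) - t) * D := by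
    simp only [hA, hB, hC, hD]; push_cast; rw [ht]
    have hS' : S = (1 - z) * ((k₁ : ℝ) + ((k₂ : ℝ) - k₁) * lam) := hmean.symm
    rw [hS']; ring
  -- `k₁ ≤ ag(1−z)`: from `k₁ + k₂ ≤ t = S + ag(1−z)` and `S ≤ k₂`
  have hSk₂ : S ≤ (k₂ : ℝ) := by
    rw [← hmean]
    have h1 : (k₁ : ℝ) + ((k₂ : ℝ) - k₁) * lam ≤ k₂ := by nlinarith
    have h2 : 0 ≤ (k₁ : ℝ) + ((k₂ : ℝ) - k₁) * lam := by nlinarith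
    nlinarith
  have hk₁α : (k₁ : ℝ) ≤ (a : ℝ) * g * (1 - z) := by rw [ht] at hincomp; linarith
  -- (c1) `k₁·A ≤ (t − ℓ)·B`
  have hc1 : (k₁ : ℝ) * A ≤ (t - ((k₁ + a : ℕ) : ℝ)) * B := by
    have hal : (a : ℝ) ≤ t - ((k₁ + a : ℕ) : ℝ) := by push_cast at hllow ⊢; linarith
    have h1 : (k₁ : ℝ) * (1 - g) ≤ (t - ((k₁ + a : ℕ) : ℝ)) * g := by
      have h2 : (k₁ : ℝ) * (1 - g) ≤ k₁ := by nlinarith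
      have h3 : (a : ℝ) * g * (1 - z) ≤ (a : ℝ) * g := by nlinarith [mul_nonneg ha0 hg0.le]
      have h4 : (a : ℝ) * g ≤ (t - ((k₁ + a : ℕ) : ℝ)) * g := mul_le_mul_of_nonneg_right hal hg0.le
      linarith
    have hcl : 0 ≤ (1 - z) * (1 - lam) := mul_nonneg h1z.le h1lam
    calc (k₁ : ℝ) * A = (1 - z) * (1 - lam) * ((k₁ : ℝ) * (1 - g)) := by simp only [hA]; ring
      _ ≤ (1 - z) * (1 - lam) * ((t - ((k₁ + a : ℕ) : ℝ)) * g) := mul_le_mul_of_nonneg_left h1 hcl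
      _ = (t - ((k₁ + a : ℕ) : ℝ)) * B := by simp only [hB]; ring
  -- (c2) `(k₂ − t)·C ≤ 0`, (c3) `(k₂ + a − t)·D ≤ t(1−y)/y·D`
  have hk₂t : (k₂ : ℝ) ≤ t := by linarith
  have hc2 : ((k₂ : ℝ) - t) * C ≤ 0 := mul_nonpos_of_nonpos_of_nonneg (by linarith) hC0
  have hc3 : (((k₂ + a : ℕ) : ℝ) - t) * D ≤ t * (1 - y) / y * D := by
    refine mul_le_mul_of_nonneg_right ?_ hD0
    rw [le_div_iff₀ hy0]; nlinarith
  -- the scalar inequality `y·(z + A) ≤ (1 − y)·D`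
  have hS1 : y * (z + A) ≤ (1 - y) * D := by
    have h1 : t * (z + A) ≤ t * (1 - y) / y * D := by
      have e : t * (z + A) = (k₁ : ℝ) * A - (t - ((k₁ + a : ℕ) : ℝ)) * B + ((k₂ : ℝ) - t) * C + (((k₂ + a : ℕ) : ℝ) - t) * D := by
        rw [mul_add, hmeanid]; ring
      rw [e]; linarith [hc1, hc2, hc3]
    have h2 : z + A ≤ (1 - y) / y * D := by
      have e : t * (1 - y) / y * D = t * ((1 - y) / y * D) := by ring
      rw [e] at h1
      exact le_of_mul_le_mul_left h1 ht0
    have := mul_le_mul_of_nonneg_left h2 hy0.le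
    have e : y * ((1 - y) / y * D) = (1 - y) * D := by field_simp
    linarith [this, e.le, e.ge]
  have hu : usage y t j k₁ (k₂ + a) = y / (1 - y) := usage_giant_eq y t j k₁ (k₂ + a) hk₂aG
  have hul : usage y t j (k₁ + a) (k₂ + a) = y / (1 - y) := usage_giant_eq y t j (k₁ + a) (k₂ + a) hk₂aG
  -- apply the routing theorem with x₁K = 0, x₁G = A, x₂K = B, x₂G = 0
  refine mixLawQ_decAtT_of_routing_deep y z g S lam a j M k₁ k₂ 0 A B 0 hy0 hy1 hz0 hz1 hg1 hyg ha hta hk hk₂M hlam0 hlam1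
    hmean hk₁ hlj hllow (Or.inl hk₂mid) hk₂aG le_rfl hA0 hB0 le_rfl (by simp only [hA]; ring) (by simp only [hB]; ring)
    (fun h0 => absurd h0 (lt_irrefl 0)) (fun _ => Or.inr hcompl) ?_ ?_ ?_
  · -- capacity of the mid k₂: only ℓ rides it
    rw [mul_zero, zero_add]; exact hunsat
  · -- capacity of the giant: k₁ rides it
    rw [← ht, hu, hul]
    simp only [mul_zero, add_zero]
    rw [div_mul_eq_mul_div, div_le_iff₀ h1y]
    nlinarith [mul_nonneg hy0.le hz0]
  · -- the offer inequality: the priced leftover of the giant absorbs the zero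
    rw [← ht, hu, hul, if_neg (show ¬ (j + 1 ≤ k₂) by omega), if_neg (show ¬ (t < (k₂ : ℝ)) by linarith)]
    simp only [mul_zero, add_zero, zero_mul, zero_add]
    have e : t * (1 - y) / y * ((1 - z) * lam * g - y / (1 - y) * A) = t * ((1 - y) / y * D - A) := by simp only [hD]; field_simp
    rw [e]
    refine mul_le_mul_of_nonneg_left ?_ ht0.le
    rw [le_sub_iff_add_le, div_mul_eq_mul_div, le_div_iff₀ hy0]
    linarith

end LawDec

end Quant

end Summit.CriticalPhenomena.PercolationContinuityZ3.Theorems
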